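import Summits.QuantumFields.YangMills.Theorems.BalabanUVNodesN27AtSpineReadingOfRecord13CoPHVCut
import Summits.QuantumFields.YangMills.Theorems.BalabanUVNodesN27AtKernelPinnedReading13CoPH
import Summits.QuantumFields.YangMills.Theorems.BalabanUVNodesN21KeyedShellWeightShellZero
import Literature.MathematicalPhysics.QuantumFieldTheory.Balaban1983to89.Node00.Record12MeasurabilityAbsolute

/-!
# BalabanUVNodes ∕ N27 = binder B5 AT THE RECORD — **BOTH v3 PINS BY NAME**: the RATE reading PINNED TO THE KERNEL OBJECTS OF RECORD (dag-n27-w1 (K)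
# `…N27AtKernelPinnedReading13CoPH` p594329: `hpin` = v3's `U3PinnedKernels 𝔯 ℓ` VERBATIM) AND the SPINE reading PINNED AT dag-n20-d's PHYSICAL-VOLUME READING OF RECORD WITH THE
# CUT READ PER TUPLE (this lineage's UC `…N27AtSpineReadingOfRecord13CoPHVCut`: `fun F θ hP g₀ os ↦ crOfRecord₁₃VAt K₀ (jc F θ hP g₀ os) sh F θ hP g₀ os` = v3's `PinnedAtLive jc sh cr`
# witness at `K₀ = 0`) — the v3 successor of VV `…N27AtBothReadingsOfRecord13CoPHV` (p591945, both v2-era readings of record)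
# (cell `pub-ymgap`, HUMAN RULING D-0062 Track A, R134 seat `pub-ymgap-dag-n27-c` (N27 B5 composite, s2) gen 12, HOME triggers (t3) plan g81 K3⁷ skeleton v3 02f6f498332fdbee + (t2) a
# producer face at a reading of record not knitted to the spine pin by its declarer; K3⁷ `SpineGivenEndpointR13SepCoPH` = stmt-QuantumFields-20544, `--kind proof --supports 20544 --as
# helper`; COUNT-NEUTRAL; THEOREMS ONLY, 0 `def`, 0 `sorry`; `N`-generic, `K₀`-generic, regime-generic, NO Theses import — item faces in leaf `…N27SpineGivenEndpointR13SepCoPHBothPinsOfRecordV`)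

WHY.  v3's stub 1 quantifies `∃ 𝔯 ksel ℓ, GuardedReading 𝔯 ksel ℓ ∧ …` with `U3PinnedKernels 𝔯 ℓ` inside the guard, and stub 2 quantifies `∃ jc sh cr, PinnedAtLive jc sh cr ∧ …`.  dag-n27-w1's
(K) composes the K4 half AT A KERNEL-PINNED RATE READING over (Q) §1 with the spine reading `cr` a PARAMETER (K5 as sentences `S_N20 ∕ S_N21 (SRec₁₃CoPHOn cr Rg)`, `hx`, `h19`); UC
composes the K5 half AT THE PER-TUPLE-CUT SPINE READING with the rate side generic.  This file is their MEET: (K) `spine_rec13CCoPHOn_holder_of_kernels_pin_bundled` INSTANTIATED at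
UC's reading, the K5 sentences READ OFF dag-n20-d's dictionary in witness form (`relWeightBound_∕shellWeightBound_∕core_crOfRecord₁₃VAt` per tuple at `jcut := jc F θ hP g₀ os`), the
N27x slot a THEOREM (UC §0 `keyedExtraction_crOfRecord₁₃VAt_cut` under the live-selector pin and the laws).  What is then displayed is NOTHING PARAMETRIC but the nodes' in-edges at the two
readings of record: N14 ∕ N15 ∕ N16-at-β as sentences at `RRec₁₃CoPHOn 𝔯 Rg`, N18 ∕ N22 on the kernel bundles `(rateCarriersOfRecord₁₃CoPH 𝔯 …).u3`, (D4)'s four kernel inputs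
(`Signs`, `0 < κ`, `betaPrime510 4 1 κ ≤ cr`, the (5.10) clause `KernelDecayOfRecord₁₃ F N θ 0 1 κ`), N17 ELIMINATED (dag-n17-a), N20 ∕ N21 ∕ N19′ as keyed witnesses at the spine
reading's carriers, ONE law (H-ζ) `ZetaMeasurable θ.ζ` (of n20-d's three extraction laws, (H-U) is node00-def-K0c's hypothesis-free theorem `localBgMeasurable` and `0 ≤ ζ` is
dag-n20-w2's `zeta_nonneg_of_provisos₁₃CoPH` — both SUPPLIED here) — and the selector pin per tuple (§1) or nothing more (§2, live regime).

WHAT IS KERNEL-CHECKED ([bookkeeping]; each ONE application of (K) with dag-n20-d's transfers in the K5 slots, per tuple).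
* §1 ★★ `spine_rec13CCoPHOn_of_kernels_pin_at_crOfRecord₁₃VAt_cut` — B5 at the regime record class `IsRecordOfRecord₁₃CCoPHOn F N Rg` from both pinned halves; `hsel` PER TUPLE.
* §2 ★★★ `spine_rec13CCoPHOn_live_of_kernels_pin_at_crOfRecord₁₃VAt_cut` — the same ON THE LIVE LINE of a regime `G` (`Rg := G ∧ LiveSel` spelled `N`-generically; `hsel` read off the
  regime): at `N = 2`, `Rg :=` the item's guard, `K₀ = 0` this is v3's stub-1 ∧ stub-2 CONTENT at the two pins, binder by binder, composed to B5 — the leaf gives THE ITEM.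
Consumed BY NAME: dag-n27-w1 (K) p594329 (and through it g0 `readOutAt_objectsOfRecord₁₃_coPH` p591653, dag-n17-a `s_N17_of_D4_N18`, (Q) p581033); UC (gen 12); dag-n20-d p590105 ∕
p587226; node00-def-W1 `objectsOfRecord₁₃ ∕ KernelDecayOfRecord₁₃` (W1-19 p590183).  Nothing landed is edited or re-declared.

HONEST FRAMING.  COMPOSITE-node bookkeeping BY NAME; a REDUCTION, not a discharge; every displayed antecedent — NE1′ ∕ NE2 ∕ NE3-at-β sentences, NE5 ∕ NE9 at the kernel bundles of
record, print's (5.10) clause for the limiting (1.21) kernels (NOT proved anywhere in the tree at these objects), the keyed NE7b ∕ NE7c ∕ NE7 witnesses, the laws, the selector pin —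
is a HYPOTHESIS inhabited for no family today (K0⁷ `Record13SepCoPHInhabited` OPEN); `jc`, `sh`, `ℓ`, `𝔯`, `β` are FREE PARAMETERS (no reading minted here); nothing of Bałaban's
asserted or instantiated; N14–N22 ∕ N27 NOT discharged (the chair books, R417); K3⁷ OPEN, NOT claimed; skeleton v3 untouched (plan's); counts UNMOVED (typed 28∕28 · discharged 5∕27,
A 5∕28); one finite four-torus programme at fixed `ε` — NOT ℝ⁴, NOT infinite volume, NOT OS, NOT a mass gap, NOT Clay.  No decl below carries a cite tag.
-/

set_option autoImplicit false

namespace Summit.QuantumFields.YangMills.Theorems.BalabanUVNodesN27SpineRecord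

open scoped BigOperators
open Literature.MathematicalPhysics.QuantumFieldTheory.Balaban1983to89
open Literature.MathematicalPhysics.QuantumFieldTheory.Balaban1983to89.T4Continuum
open Literature.MathematicalPhysics.QuantumFieldTheory.Balaban1983to89.Node00
open Literature.MathematicalPhysics.QuantumFieldTheory.Balaban1983to89.B12Sec2to5 (betaPrime510)
open Literature.MathematicalPhysics.QuantumFieldTheory.Balaban1983to89.Node00.U3OfKernels (objectsOfRecord₁₃ KernelDecayOfRecord₁₃)
open T4WeightBudget (RelWeightBound)
open T4IndicatorShell (ShellWeightBound)
open T4ContinuumYM4Torus (ForSmallCouplings)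
open Summit.QuantumFields.BalabanUV.T4Continuum.Spine
open YMDAG.UVSplit
open Summit.QuantumFields.YangMills.BalabanUVNodes.SpineCanonicalWeights (core_nonneg_of_shellWeightBound)
open Summit.QuantumFields.YangMills.BalabanUVNodes.N19TargetClassWeightsE1Keyed
open Summit.QuantumFields.YangMills.BalabanUVNodes.N16HolderDefs (S_N16Holder)
open Summit.QuantumFields.YangMills.BalabanUVNodes.SpineRatesHolder (RatesHolderAt)
open Summit.QuantumFields.YangMills.BalabanUVNodes.N21KeyedShellWeightShellZero (zeta_nonneg_of_provisos₁₃CoPH)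

variable {N : ℕ} [NeZero N] (K₀ : ℕ)
  (jc : (F : T4Family) → (θ : Stage13HParams F N) → θ.Provisos₁₃CoPH F N → (ℕ → ℝ) → List (ULoop F) → ℕ → ℕ)
  (sh : ShellSplit₁₃CoPH N K₀) (β : ℝ) (𝔯 : RateReading₁₃CoPH N) (ℓ : (F : T4Family) → Stage13HParams F N → U3Letters₁₁)

/-! ## §1 Both pins, any regime (`hsel` per tuple) -/

/-- ★★ **N27 = B5 AT THE REGIME RECORD CLASS WITH BOTH v3 PINS: K4 AT A KERNEL-PINNED RATE READING (dag-n27-w1 (K), bundled form), K5 AT THE PER-TUPLE-CUT SPINE READING OF RECORD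
(UC)** — from: the pin `hpin` (= `U3PinnedKernels 𝔯 ℓ`); N14 ∕ N15 ∕ N16-at-β as sentences at `RRec₁₃CoPHOn 𝔯 Rg`; N18 ∕ N22 on the kernel bundles of every run length; (D4)'s four
kernel inputs per guarded tuple (`Signs`, `0 < κ`, `betaPrime510 4 1 κ ≤ cr`, `KernelDecayOfRecord₁₃ F N θ 0 1 κ`) — N17 ELIMINATED inside (K); the selector pin `hsel` and the law `hζm` — (H-U) `LocalBgMeasurable` and `0 ≤ ζ` are THEOREMS at the tuple
(node00-def-K0c `localBgMeasurable`, dag-n20-w2 `zeta_nonneg_of_provisos₁₃CoPH`), supplied here (⇒ N27x, UC §0); keyed N20 ∕ N21 witnesses at the reading's carriers with the tuple's own cut depth; the N19′ edge reading `∀ k, RatesHolderAt … β` to a summable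
`NE7.Core 1 (F.side ^ 4)` witness ⇒ `Spine` at `IsRecordOfRecord₁₃CCoPHOn F N Rg`.  (K) `spine_rec13CCoPHOn_holder_of_kernels_pin_bundled` at `cr := fun F θ hP g₀ os ↦
crOfRecord₁₃VAt K₀ (jc F θ hP g₀ os) sh F θ hP g₀ os`.  Every displayed antecedent a HYPOTHESIS (0∕1 today); (5.10) NOT proved. [bookkeeping] -/
theorem spine_rec13CCoPHOn_of_kernels_pin_at_crOfRecord₁₃VAt_cut (Rg : (F : T4Family) → Stage13HParams F N → Prop)
    (hpin : ∀ (F : T4Family) (θ : Stage13HParams F N) (hP : θ.Provisos₁₃CoPH F N) (g₀ : ℕ → ℝ) (os : List (ULoop F)),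
      (𝔯.lit F θ hP g₀ os).u3 = objectsOfRecord₁₃ F N θ.toStage13Params (ℓ F θ))
    (h14 : S_N14 (RRec₁₃CoPHOn 𝔯 Rg)) (h15 : S_N15 (RRec₁₃CoPHOn 𝔯 Rg)) (h16 : S_N16Holder β (RRec₁₃CoPHOn 𝔯 Rg))
    (h18 : ∀ (F : T4Family) (θ : Stage13HParams F N) (hP : θ.Provisos₁₃CoPH F N), Rg F θ → θ.Admissible F N → ∀ (g₀ : ℕ → ℝ) (os : List (ULoop F)) (k : ℕ),
      N18At (rateCarriersOfRecord₁₃CoPH 𝔯 F θ hP g₀ os k).u3)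
    (h22 : ∀ (F : T4Family) (θ : Stage13HParams F N) (hP : θ.Provisos₁₃CoPH F N), Rg F θ → θ.Admissible F N → ∀ (g₀ : ℕ → ℝ) (os : List (ULoop F)) (k : ℕ),
      N22At (rateCarriersOfRecord₁₃CoPH 𝔯 F θ hP g₀ os k).u3)
    (hs : ∀ (F : T4Family) (θ : Stage13HParams F N), θ.Provisos₁₃CoPH F N → Rg F θ → θ.Admissible F N → (ℓ F θ).Signs)
    (hκ : ∀ (F : T4Family) (θ : Stage13HParams F N), θ.Provisos₁₃CoPH F N → Rg F θ → θ.Admissible F N → 0 < (ℓ F θ).κ)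
    (hcr : ∀ (F : T4Family) (θ : Stage13HParams F N), θ.Provisos₁₃CoPH F N → Rg F θ → θ.Admissible F N → betaPrime510 4 1 (ℓ F θ).κ ≤ (ℓ F θ).cr)
    (hdec : ∀ (F : T4Family) (θ : Stage13HParams F N), θ.Provisos₁₃CoPH F N → Rg F θ → θ.Admissible F N → KernelDecayOfRecord₁₃ F N θ.toStage13Params 0 1 (ℓ F θ).κ)
    (hsel : ∀ (F : T4Family) (θ : Stage13HParams F N), θ.Provisos₁₃CoPH F N → Rg F θ → θ.Admissible F N →
      ∃ E : B12.RunParams → ℝ, θ.ppSel = ppSelLiveOfRecord F N θ.ν θ.τ9 E (wOfRecord₉ F N θ.toStage9Params))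
    (hζm : ∀ (F : T4Family) (θ : Stage13HParams F N), θ.Provisos₁₃CoPH F N → Rg F θ → θ.Admissible F N → ZetaMeasurable F N θ.ζ)
    (h20 : ∀ (F : T4Family) (θ : Stage13HParams F N) (hP : θ.Provisos₁₃CoPH F N), Rg F θ → θ.Admissible F N → ∀ (g₀ : ℕ → ℝ) (os : List (ULoop F)),
      ∃ W : ℕ → ℝ, RelWeightBound 1 (classSet₁₃ θ K₀ g₀) (weightA₁₃ θ hP K₀ g₀ os) (weightB₁₃ θ hP K₀ g₀ os) (badClass₁₃ θ K₀ g₀ (jc F θ hP g₀ os)) W)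
    (h21 : ∀ (F : T4Family) (θ : Stage13HParams F N) (hP : θ.Provisos₁₃CoPH F N), Rg F θ → θ.Admissible F N → ∀ (g₀ : ℕ → ℝ) (os : List (ULoop F)),
      ∃ Wsh : ℕ → ℝ, ShellWeightBound 1 (classSet₁₃ θ K₀ g₀) (weightA₁₃ θ hP K₀ g₀ os) (weightB₁₃ θ hP K₀ g₀ os) (sh F θ hP g₀ os).1 (sh F θ hP g₀ os).2 Wsh)
    (h19 : ∀ (F : T4Family) (θ : Stage13HParams F N) (hP : θ.Provisos₁₃CoPH F N), Rg F θ → θ.Admissible F N → ∀ (g₀ : ℕ → ℝ) (os : List (ULoop F)),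
      (∀ k : ℕ, RatesHolderAt (datumOfRecord₁₃CoPH F N θ hP) (rateCarriersOfRecord₁₃CoPH 𝔯 F θ hP g₀ os k) β) →
        letI : DecidableEq (Σ K, SiteSeqKey F (K₀ + K)) := Classical.decEq _
        ∃ δ : ℕ → ℝ, NE7.Core 1 (F.side ^ 4) (classSet₁₃ θ K₀ g₀) (badClass₁₃ θ K₀ g₀ (jc F θ hP g₀ os)) (fun K t x => weightA₁₃ θ hP K₀ g₀ os K t x - (sh F θ hP g₀ os).1 K t x)
          (fun K t x => weightB₁₃ θ hP K₀ g₀ os K t x - (sh F θ hP g₀ os).2 K t x) δ ∧ Summable δ) :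
    Spine (N := N) fun F D w => Node00.IsRecordOfRecord₁₃CCoPHOn F N Rg D w :=
  spine_rec13CCoPHOn_holder_of_kernels_pin_bundled (fun F θ hP g₀ os => crOfRecord₁₃VAt K₀ (jc F θ hP g₀ os) sh F θ hP g₀ os) β 𝔯 Rg ℓ hpin h14 h15 h16 h18 h22
    hs hκ hcr hdec
    ((s_N20_sRec₁₃CoPHOn_iff (fun F θ hP g₀ os => crOfRecord₁₃VAt K₀ (jc F θ hP g₀ os) sh F θ hP g₀ os) Rg).mpr fun F θ hP hRg hθ g₀ os => by
      obtain ⟨W, hW⟩ := h20 F θ hP hRg hθ g₀ os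
      exact relWeightBound_crOfRecord₁₃VAt K₀ (jc F θ hP g₀ os) sh θ hP g₀ os hW)
    (by
      rintro F D g₀ os S ⟨θ, hP, hRg, hθ, -, rfl⟩
      obtain ⟨Wsh, hWsh⟩ := h21 F θ hP hRg hθ g₀ os
      exact shellWeightBound_crOfRecord₁₃VAt K₀ (jc F θ hP g₀ os) sh θ hP g₀ os hWsh)
    (fun F θ hP hRg hθ _ _ => by
      obtain ⟨E, hE⟩ := hsel F θ hP hRg hθ
      exact keyedExtraction_crOfRecord₁₃VAt_cut K₀ jc sh θ hP E hE (localBgMeasurable F N θ.ν) (hζm F θ hP hRg hθ) (zeta_nonneg_of_provisos₁₃CoPH F θ hP))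
    (fun F θ hP hRg hθ g₀ os hk => by
      letI : DecidableEq (Σ K, SiteSeqKey F (K₀ + K)) := Classical.decEq _
      obtain ⟨Wsh, hWsh⟩ := h21 F θ hP hRg hθ g₀ os
      obtain ⟨δ, hδ, hsum⟩ := h19 F θ hP hRg hθ g₀ os hk
      exact ⟨_, core_crOfRecord₁₃VAt K₀ (jc F θ hP g₀ os) sh θ hP g₀ os (core_nonneg_of_shellWeightBound hWsh) hδ hsum⟩)

/-! ## §2 Both pins ON THE LIVE-SELECTOR LINE of a regime `G` (`hsel` read off the regime) -/

/-- ★★★ **N27 = B5 ON THE LIVE LINE OF A REGIME `G` WITH BOTH v3 PINS** — §1 at `Rg := G ∧ LiveSel` (v3's `LiveSel` spelled `N`-generically), the selector pin READ OFF THE REGIME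
(`E := EOfRecord₁₃ F N θ.toStage13Params`): K4 at the kernel-pinned rate reading (dag-n27-w1 (K)), K5 at the per-tuple-cut physical-volume spine reading of record (UC), N17 eliminated,
N27x a theorem; displayed = the nodes' in-edges at the two readings and the one law `hζm`, nothing else.  At `N = 2`, `Rg :=` the item's guard and `K₀ = 0` this is v3's stub-1 ∧ stub-2 content
AT THEIR PINS composed to B5 (the leaf `…SepCoPHBothPinsOfRecordV` gives THE ITEM).  Every displayed antecedent a HYPOTHESIS (0∕1 today); (5.10) ∕ NE-estimates NOT proved.
[bookkeeping] -/
theorem spine_rec13CCoPHOn_live_of_kernels_pin_at_crOfRecord₁₃VAt_cut (G : (F : T4Family) → Stage13HParams F N → Prop)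
    (hpin : ∀ (F : T4Family) (θ : Stage13HParams F N) (hP : θ.Provisos₁₃CoPH F N) (g₀ : ℕ → ℝ) (os : List (ULoop F)),
      (𝔯.lit F θ hP g₀ os).u3 = objectsOfRecord₁₃ F N θ.toStage13Params (ℓ F θ))
    (h14 : S_N14 (RRec₁₃CoPHOn 𝔯 fun F θ => G F θ ∧ θ.ppSel = ppSelLiveOfRecord F N θ.ν θ.τ9 (EOfRecord₁₃ F N θ.toStage13Params) (wOfRecord₉ F N θ.toStage9Params)))
    (h15 : S_N15 (RRec₁₃CoPHOn 𝔯 fun F θ => G F θ ∧ θ.ppSel = ppSelLiveOfRecord F N θ.ν θ.τ9 (EOfRecord₁₃ F N θ.toStage13Params) (wOfRecord₉ F N θ.toStage9Params)))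
    (h16 : S_N16Holder β (RRec₁₃CoPHOn 𝔯 fun F θ => G F θ ∧ θ.ppSel = ppSelLiveOfRecord F N θ.ν θ.τ9 (EOfRecord₁₃ F N θ.toStage13Params) (wOfRecord₉ F N θ.toStage9Params)))
    (h18 : ∀ (F : T4Family) (θ : Stage13HParams F N) (hP : θ.Provisos₁₃CoPH F N),
      (G F θ ∧ θ.ppSel = ppSelLiveOfRecord F N θ.ν θ.τ9 (EOfRecord₁₃ F N θ.toStage13Params) (wOfRecord₉ F N θ.toStage9Params)) → θ.Admissible F N →
        ∀ (g₀ : ℕ → ℝ) (os : List (ULoop F)) (k : ℕ), N18At (rateCarriersOfRecord₁₃CoPH 𝔯 F θ hP g₀ os k).u3)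
    (h22 : ∀ (F : T4Family) (θ : Stage13HParams F N) (hP : θ.Provisos₁₃CoPH F N),
      (G F θ ∧ θ.ppSel = ppSelLiveOfRecord F N θ.ν θ.τ9 (EOfRecord₁₃ F N θ.toStage13Params) (wOfRecord₉ F N θ.toStage9Params)) → θ.Admissible F N →
        ∀ (g₀ : ℕ → ℝ) (os : List (ULoop F)) (k : ℕ), N22At (rateCarriersOfRecord₁₃CoPH 𝔯 F θ hP g₀ os k).u3)
    (hs : ∀ (F : T4Family) (θ : Stage13HParams F N), θ.Provisos₁₃CoPH F N →
      (G F θ ∧ θ.ppSel = ppSelLiveOfRecord F N θ.ν θ.τ9 (EOfRecord₁₃ F N θ.toStage13Params) (wOfRecord₉ F N θ.toStage9Params)) → θ.Admissible F N → (ℓ F θ).Signs)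
    (hκ : ∀ (F : T4Family) (θ : Stage13HParams F N), θ.Provisos₁₃CoPH F N →
      (G F θ ∧ θ.ppSel = ppSelLiveOfRecord F N θ.ν θ.τ9 (EOfRecord₁₃ F N θ.toStage13Params) (wOfRecord₉ F N θ.toStage9Params)) → θ.Admissible F N → 0 < (ℓ F θ).κ)
    (hcr : ∀ (F : T4Family) (θ : Stage13HParams F N), θ.Provisos₁₃CoPH F N →
      (G F θ ∧ θ.ppSel = ppSelLiveOfRecord F N θ.ν θ.τ9 (EOfRecord₁₃ F N θ.toStage13Params) (wOfRecord₉ F N θ.toStage9Params)) → θ.Admissible F N →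
        betaPrime510 4 1 (ℓ F θ).κ ≤ (ℓ F θ).cr)
    (hdec : ∀ (F : T4Family) (θ : Stage13HParams F N), θ.Provisos₁₃CoPH F N →
      (G F θ ∧ θ.ppSel = ppSelLiveOfRecord F N θ.ν θ.τ9 (EOfRecord₁₃ F N θ.toStage13Params) (wOfRecord₉ F N θ.toStage9Params)) → θ.Admissible F N →
        KernelDecayOfRecord₁₃ F N θ.toStage13Params 0 1 (ℓ F θ).κ)
    (hζm : ∀ (F : T4Family) (θ : Stage13HParams F N), θ.Provisos₁₃CoPH F N →
      (G F θ ∧ θ.ppSel = ppSelLiveOfRecord F N θ.ν θ.τ9 (EOfRecord₁₃ F N θ.toStage13Params) (wOfRecord₉ F N θ.toStage9Params)) → θ.Admissible F N → ZetaMeasurable F N θ.ζ)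
    (h20 : ∀ (F : T4Family) (θ : Stage13HParams F N) (hP : θ.Provisos₁₃CoPH F N),
      (G F θ ∧ θ.ppSel = ppSelLiveOfRecord F N θ.ν θ.τ9 (EOfRecord₁₃ F N θ.toStage13Params) (wOfRecord₉ F N θ.toStage9Params)) → θ.Admissible F N →
        ∀ (g₀ : ℕ → ℝ) (os : List (ULoop F)),
          ∃ W : ℕ → ℝ, RelWeightBound 1 (classSet₁₃ θ K₀ g₀) (weightA₁₃ θ hP K₀ g₀ os) (weightB₁₃ θ hP K₀ g₀ os) (badClass₁₃ θ K₀ g₀ (jc F θ hP g₀ os)) W)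
    (h21 : ∀ (F : T4Family) (θ : Stage13HParams F N) (hP : θ.Provisos₁₃CoPH F N),
      (G F θ ∧ θ.ppSel = ppSelLiveOfRecord F N θ.ν θ.τ9 (EOfRecord₁₃ F N θ.toStage13Params) (wOfRecord₉ F N θ.toStage9Params)) → θ.Admissible F N →
        ∀ (g₀ : ℕ → ℝ) (os : List (ULoop F)),
          ∃ Wsh : ℕ → ℝ, ShellWeightBound 1 (classSet₁₃ θ K₀ g₀) (weightA₁₃ θ hP K₀ g₀ os) (weightB₁₃ θ hP K₀ g₀ os) (sh F θ hP g₀ os).1 (sh F θ hP g₀ os).2 Wsh)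
    (h19 : ∀ (F : T4Family) (θ : Stage13HParams F N) (hP : θ.Provisos₁₃CoPH F N),
      (G F θ ∧ θ.ppSel = ppSelLiveOfRecord F N θ.ν θ.τ9 (EOfRecord₁₃ F N θ.toStage13Params) (wOfRecord₉ F N θ.toStage9Params)) → θ.Admissible F N →
        ∀ (g₀ : ℕ → ℝ) (os : List (ULoop F)),
          (∀ k : ℕ, RatesHolderAt (datumOfRecord₁₃CoPH F N θ hP) (rateCarriersOfRecord₁₃CoPH 𝔯 F θ hP g₀ os k) β) →
            letI : DecidableEq (Σ K, SiteSeqKey F (K₀ + K)) := Classical.decEq _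
            ∃ δ : ℕ → ℝ, NE7.Core 1 (F.side ^ 4) (classSet₁₃ θ K₀ g₀) (badClass₁₃ θ K₀ g₀ (jc F θ hP g₀ os)) (fun K t x => weightA₁₃ θ hP K₀ g₀ os K t x - (sh F θ hP g₀ os).1 K t x)
              (fun K t x => weightB₁₃ θ hP K₀ g₀ os K t x - (sh F θ hP g₀ os).2 K t x) δ ∧ Summable δ) :
    Spine (N := N) fun F D w => Node00.IsRecordOfRecord₁₃CCoPHOn F N
      (fun F θ => G F θ ∧ θ.ppSel = ppSelLiveOfRecord F N θ.ν θ.τ9 (EOfRecord₁₃ F N θ.toStage13Params) (wOfRecord₉ F N θ.toStage9Params)) D w :=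
  spine_rec13CCoPHOn_of_kernels_pin_at_crOfRecord₁₃VAt_cut K₀ jc sh β 𝔯 ℓ _ hpin h14 h15 h16 h18 h22 hs hκ hcr hdec (fun _ _ _ hRg _ => ⟨_, hRg.2⟩)
    hζm h20 h21 h19

end Summit.QuantumFields.YangMills.Theorems.BalabanUVNodesN27SpineRecord
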